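/-
Copyright (c) 2026 the pub-hodgecm-mathlib formalisation cell (harness21).  Prover seat hodgecm-mathlib-K2E1-p14 (g2), Track B «K2-LIT» ENGINE E1, h413 =
`stmt-HodgeConjecture-24833`, route `HCCMUnconditional`, 5Res ROADCARD «ENDGAME BY FAMILIES» §3′ D4′c (SD) AT THE MAXIMAL LEVEL M1 (dealer K2E1-plan (g7) (249)): the
self-dual block isometry of ★ `K2E1ChiSectionPlancherelSelfDualCMTwo` INSTANTIATED at `K′ = K_max`, `ω = 1` — rank one: `M(z) = s(z)•id`, `R_c = ρ_c•id`.
-/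
import Summits.HodgeConjecture.HodgeConjecture.Theorems.K2E1ChiSectionPlancherelSelfDualCMTwo      -- ★ p860386 (K2E4-p10): `exists_linearIsometry_selfDual_of_pureTensor_letters`, `finiteDimensional_span_range` (+ ★ p860321 on letters)
import Summits.HodgeConjecture.HodgeConjecture.Theorems.K2E1ChiScatteringConjSymmetryM1CMTwo       -- ★ p860445 (K2E1-p13): `chi_scattering_conj_symm_m1_cm_two`, `exists_galTwist_cm`
import Summits.HodgeConjecture.HodgeConjecture.Theorems.K2E1ChiUnitaryAxisContinuationCMTwo        -- ★ p860080 (K2E1-p13): `continuous_axis_of_fe_of_conj`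
import Summits.HodgeConjecture.HodgeConjecture.Theorems.K2E1ChiSectionSpaceU2Defs                 -- ★ D1: `chiSectionSpace`, `apply_mul_of_mem`, `isChiSection_of_mem`
import HarnessLib

/-!
# D4′c (SD) at M1 — `K2E1ChiSectionPlancherelSelfDualM1CMTwo`: THE PLANCHEREL ISOMETRY OF A SELF-DUAL `χ`-BLOCK OF `U(1,1)_{L∕L⁺}` AT THE MAXIMAL LEVEL
# `K′ = K_max`, `ω = 1` — THE RANK-ONE ASSEMBLY ON THE REMAINING SCALAR LETTERS

Track B ∕ K2-LIT, crux h413 = `stmt-HodgeConjecture-24833`, route of record `HCCMUnconditional`; cell `hodgecm-mathlib`, squad K2, ENGINE E1.  THEOREMS ONLY (no `def`, no `instance`,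
no `notation`, no named-fact hypothesis, no `sorry`; default heartbeats); lane `--supports stmt-HodgeConjecture-24833 --as helper` (count-neutral).

THE MATHEMATICS ([MoeglinWaldspurger1995, II.1.7, II.2.4, IV.1.10, IV.3.12]; [Langlands1976, §7]; [Iwaniec2002, §7.3]).  At the maximal level every section `φ ∈ V(χ, K_max, 1)` is
right-`K_max`-invariant (★ `apply_mul_of_mem`, `ω = 1`), so `φ|_{K_max} ≡ φ(1)`: the `L²(K_U)`-model `W = span {v_a} ≤ L²(K_max, μ_K)` of ★ `K2E1ChiSectionPlancherelSelfDualCMTwo` §3∕§4 is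
the LINE OF CONSTANTS and the operator datum of the self-dual block is FORCED — `M(z) = s(z)•id_W`, `R_c = ρ_c•id_W`, with `s = c(·; χ)` the rank-one scattering scalar of the self-dual
unitary `χ` (Godement-range formula `s(z) = r·φ₀(1)⁻¹·∫_{N(𝔸)} f_z^{φ₀}(w₀ v) dν` for a normalised `φ₀ ∈ V(χ, K_max, 1)`, meromorphic in normal form on `ℂ`, analytic off a closed
co-discrete `P ⊆ {Re ≤ 1}` — ★ M1 PRINT `K2E1ChiEisensteinMeromorphicExportsM1CMTwo`) and `ρ_c` its residues at the real poles `c ∈ S ⊂ (½, σ₀)`.  In rank one the eight vector letters of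
★ `exists_linearIsometry_selfDual_of_pureTensor_letters` collapse to SCALAR letters on `s`: the MS entries `hs∕hr∕hB` become holomorphy of `s` on `U ∖ S`, simple poles with residues
`ρ_c` (real, `≥ 0` — this IS `hRsymm∕hRpos`) and a strip bound `‖s z‖ ≤ B`; `hFE` is `s(z)s(1 − z) = 1`; `hadj` is EXACTLY the conj-symmetry `s(conj z) = conj s(z)` — ★ K2E1-p13's M1 head
`chi_scattering_conj_symm_m1_cm_two` (the «symmetry of `M(z)` in the `K`-pairing» is vacuous in rank one); `hcont` is the continuity of `t ↦ s(½ + it)`, i.e. NO POLE ON THE UNITARY AXIS,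
★ `K2E1ChiUnitaryAxisContinuationCMTwo.continuous_axis_of_fe_of_conj` from (FE) + (conj).
* §1 `exists_linearIsometry_selfDual_of_scalar_letters` — GENERIC (`H` any complex inner-product space, `V` finite-dimensional): the rank-one edition of ★ part 5 §2 with `M := s•id`,
  `R := ρ•id`, deriving the eight vector letters from the scalar ones + `hconj` + axis continuity.
* §2 HEAD **`exists_linearIsometry_chiSection_selfDual_m1_cm_two`** — THE M1 PRINT: `hadj` discharged by ★ p860445 (Galois twist ★ `exists_galTwist_cm`, right-`K_max`-invariance
  ★ `apply_mul_of_mem`), `hcont` by ★ p860080; VISIBLE BINDERS = the remaining (SD)-at-M1 bill in scalar currency: the package `(s, P)` (`hsNF hPc hPcd hPre hsan hs_tube` — ★ M1 PRINT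
  (E1)–(E3) at the singleton basis `{φ₀}` read at `g = 1`), `hs` (K2E1-p13: realness of the strip poles ∘ ★ `K2E1MeromorphicStripFinitePoles` §4), `hr∕hρim∕hρre` (K2E4-p11: simple
  real poles, residues `≥ 0`), `hB` (K2E1-p15: strip bound), `hFE` (the M1 instantiation of ★ C3 FILE 2 `chi_scattering_fe_cm_two`), `hSD` (K2E3-p12 H-c: the pure-tensor two-term
  Gram letter with `⟪ṽ_b, M(z)ṽ_a⟫ = s(z)·⟪ṽ_b, ṽ_a⟫_W`; ★ part 5 §3 `inner_mk_span_eq_integral` converts `⟪ṽ_b, ṽ_a⟫_W = ∫_{K_max} φ_a·conj φ_b dμ_K`).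
CONCLUSION (★ part 5 §4's, with `M`, `R` eliminated): `∃ r w U`, `⟪r_i, r_j⟫ = C·Σ_{c∈S} ⟪Ψ̂_i(−c), ρ_c•Ψ̂_j(−c)⟫_W`, `w_i =ᵐ Ψ̂_i(−(½+it)) + s(½−it)•Ψ̂_i(−(½−it))`,
**`U (Σ_a y_{i,a}) = (r_i, √(C∕2π)•w_i)`**, `U : closure span {Σ_a y_{i,a}} →ₗᵢ[ℂ] (⊕_{c∈S} W) ⊕₂ L²((0,∞); W)` — the block `Θ_χ^{K_max} ≅ (⊕_j Res_{χ,j}) ⊕ 𝓜_χ^{cont}` at M1.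
HONEST LABEL: HC_CM is proved only modulo the 7 printed citations (2 remaining named inputs: hLiu418 = `stmt-HodgeConjecture-24832`, h413 = `stmt-HodgeConjecture-24833`) until rung 0
closes; this file asserts no named fact, closes no socket; count-neutral; letters as listed (package, `hs`, `hr`, `hB`, `hFE`, `hSD`).

## References
* [MoeglinWaldspurger1995] C. Mœglin, J.-L. Waldspurger, *Spectral decomposition and Eisenstein series* (1995), II.1.7, II.2.4, IV.1.10, IV.3.12.
* [Langlands1976] R. P. Langlands, *On the Functional Equations Satisfied by Eisenstein Series*, LNM 544 (1976), §7.
* [Iwaniec2002] H. Iwaniec, *Spectral Methods of Automorphic Forms* (2nd ed., 2002), §7.3.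
-/

set_option autoImplicit false
set_option linter.dupNamespace false  -- the mandated namespace repeats the summit's segment (`HodgeConjecture.HodgeConjecture`)

noncomputable section

open MeasureTheory Measure Set Filter Topology Complex NumberField
open scoped Real ComplexConjugate InnerProductSpace BigOperators
open Literature.NumberTheory Literature.NumberTheory.Automorphic Literature.NumberTheory.Automorphic.UnitaryGroup AdelicGroupData
open Literature.NumberTheory.GaloisRepresentations (HeckeCharacter)
open Summit.HodgeConjecture.HodgeConjecture.Cruxes.H413.K2E1BorelEisensteinU
open Summit.HodgeConjecture.HodgeConjecture.Cruxes.H413.K2E1CharacterEisensteinU2Defs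
open Summit.HodgeConjecture.HodgeConjecture.Cruxes.H413.K2E1ChiSectionSpaceU2Defs
open Summit.HodgeConjecture.HodgeConjecture.Cruxes.H413.K2E1ChiSectionPlancherelSelfDualCMTwo (exists_linearIsometry_selfDual_of_pureTensor_letters finiteDimensional_span_range)
open Summit.HodgeConjecture.HodgeConjecture.Cruxes.H413.K2E1ChiScatteringConjSymmetryM1CMTwo (chi_scattering_conj_symm_m1_cm_two exists_galTwist_cm)
open Summit.HodgeConjecture.HodgeConjecture.Cruxes.H413.K2E1ChiUnitaryAxisContinuationCMTwo (continuous_axis_of_fe_of_conj)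
open Summit.HodgeConjecture.HodgeConjecture.Cruxes.H413.K2E1PlancherelIsometryOfForm (mem_topologicalClosure_span)

namespace Summit.HodgeConjecture.HodgeConjecture.Cruxes.H413.K2E1ChiSectionPlancherelSelfDualM1CMTwo

/-! ## §1 The self-dual block isometry in RANK ONE: `M(z) = s(z)•id`, `R_c = ρ_c•id` (generic `H`, `V`) -/

section Generic

variable {V : Type*} [NormedAddCommGroup V] [InnerProductSpace ℂ V] {H : Type*} [NormedAddCommGroup H] [InnerProductSpace ℂ H] {ι α : Type*} [Fintype α]

/-- **THE SELF-DUAL BLOCK ISOMETRY FROM SCALAR LETTERS (rank one).**  ★ part 5 §2 `exists_linearIsometry_selfDual_of_pureTensor_letters` with the forced rank-one operator datum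
`M(z) = s(z)•id_V`, `R_c = ρ_c•id_V`: the eight vector letters follow from the SCALAR ones — `hs` holomorphy of `s` on `U ∖ S`; `hr` simple poles at `c ∈ S` with residues `ρ_c`,
`hρim∕hρre` `ρ_c` real and `≥ 0` (⇒ `hRsymm∕hRpos`); `hB` strip bound; `hFE` `s(z)s(1−z) = 1`; `hconj` `s(conj z) = conj s(z)` (⇒ `hadj`); `hcont` continuity of `t ↦ s(½+it)`; `hSD` the
pure-tensor two-term Gram letter with `⟪v_b, M(z)v_a⟫ = s(z)·⟪v_b, v_a⟫`.  CONCLUSION: `∃ r w U`, `⟪r_i, r_j⟫ = C·Σ_{c∈S} ⟪Ψ̂_i(−c), ρ_c•Ψ̂_j(−c)⟫`,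
`w_i =ᵐ Ψ̂_i(−(½+it)) + s(½−it)•Ψ̂_i(−(½−it))`, `U (Σ_a y_{i,a}) = (r_i, √(C∕2π)•w_i)`. [cite: MoeglinWaldspurger1995, II.2.4 and IV.3.12] [cite: Langlands1976, §7] -/
theorem exists_linearIsometry_selfDual_of_scalar_letters [FiniteDimensional ℂ V]
    (y : ι → α → H) {f : ι → α → ℝ → ℂ}
    (hf : ∀ i a, ContDiff ℝ 2 (f i a)) (hfs : ∀ i a, HasCompactSupport (f i a)) (hf0 : ∀ i a, tsupport (f i a) ⊆ Ioi 0)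
    (v : α → V) (s : ℂ → ℂ) {σ₀ : ℝ} (hσ₀ : 1 / 2 < σ₀)
    {U : Set ℂ} (hUo : IsOpen U) (hUs : {z : ℂ | 1 / 2 ≤ z.re ∧ z.re ≤ σ₀} ⊆ U) (S : Finset ℝ) (hS : ∀ c ∈ S, 1 / 2 < c ∧ c < σ₀)
    (hs : DifferentiableOn ℂ s (U \ ((S.image fun c : ℝ => (c : ℂ)) : Set ℂ)))
    (ρ : ℝ → ℂ) (hr : ∀ c ∈ S, Tendsto (fun z : ℂ => (z - c) * s z) (𝓝[≠] (c : ℂ)) (𝓝 (ρ c)))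
    (hρim : ∀ c ∈ S, (ρ c).im = 0) (hρre : ∀ c ∈ S, 0 ≤ (ρ c).re)
    {B : ℝ} (hB : ∀ z : ℂ, 1 / 2 < z.re → z.re ≤ σ₀ → 1 ≤ |z.im| → ‖s z‖ ≤ B)
    {P : Set ℂ} (hPcd : ∀ z₀ : ℂ, ∀ᶠ w in 𝓝[≠] z₀, w ∉ P)
    (hFE : ∀ z : ℂ, z ∉ P → 1 - z ∉ P → s z * s (1 - z) = 1) (hconj : ∀ z : ℂ, z ∉ P → conj z ∉ P → s (conj z) = conj (s z))
    (hcont : Continuous fun t : ℝ => s ((((1 / 2 : ℝ)) : ℂ) + t * I))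
    {C : ℝ} (hC : 0 ≤ C)
    (hSD : ∀ i j a b, ⟪y i b, y j a⟫_ℂ = (C : ℂ) * ((((2 * π)⁻¹ : ℝ) : ℂ) * ∫ t : ℝ, mellin (f j a) (-((σ₀ : ℂ) + t * I)) *
      (⟪v b, v a⟫_ℂ * conj (mellin (f i b) (-(1 - conj ((σ₀ : ℂ) + t * I)))) + s ((σ₀ : ℂ) + t * I) * ⟪v b, v a⟫_ℂ * conj (mellin (f i b) (-conj ((σ₀ : ℂ) + t * I)))))) :
    ∃ (r : ι → PiLp 2 (fun _ : ↥S => V)) (w : ι → Lp V 2 ((volume : Measure ℝ).restrict (Ioi 0)))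
      (Uiso : (Submodule.span ℂ (Set.range fun i => ∑ a, y i a)).topologicalClosure →ₗᵢ[ℂ] WithLp 2 (PiLp 2 (fun _ : ↥S => V) × Lp V 2 ((volume : Measure ℝ).restrict (Ioi 0)))),
      (∀ i j, ⟪r i, r j⟫_ℂ = (C : ℂ) * ∑ c ∈ S, ⟪∑ b, mellin (f i b) (-(c : ℂ)) • v b, ρ c • ∑ a, mellin (f j a) (-(c : ℂ)) • v a⟫_ℂ) ∧
      (∀ i, (w i : ℝ → V) =ᵐ[(volume : Measure ℝ).restrict (Ioi 0)] fun t => (∑ a, mellin (f i a) (-((((1 / 2 : ℝ)) : ℂ) + t * I)) • v a) +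
        s ((((1 / 2 : ℝ)) : ℂ) + ((-t : ℝ) : ℂ) * I) • ∑ a, mellin (f i a) (-((((1 / 2 : ℝ)) : ℂ) + ((-t : ℝ) : ℂ) * I)) • v a) ∧
      (∀ i, Uiso ⟨∑ a, y i a, mem_topologicalClosure_span (fun i => ∑ a, y i a) i⟩ = WithLp.toLp 2 (r i, ((Real.sqrt (C * (2 * π)⁻¹) : ℝ) : ℂ) • w i)) := by
  -- the forced rank-one operator data (kept abstract through their defining equations)
  obtain ⟨M, hM⟩ : ∃ M : ℂ → V →ₗ[ℂ] V, ∀ z u, M z u = s z • u := ⟨fun z => s z • LinearMap.id, fun _ _ => rfl⟩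
  obtain ⟨R, hR⟩ : ∃ R : ℝ → V →ₗ[ℂ] V, ∀ c u, R c u = ρ c • u := ⟨fun c => ρ c • LinearMap.id, fun _ _ => rfl⟩
  -- the strip bound is nonnegative (test point `σ₀ + i`)
  have hB0 : 0 ≤ B := (norm_nonneg _).trans (hB ((σ₀ : ℂ) + I) (by simp; linarith) (by simp) (by simp))
  -- the eight vector letters of ★ part 5 §2
  have hs' : ∀ a b, DifferentiableOn ℂ (fun z : ℂ => ⟪v b, M z (v a)⟫_ℂ) (U \ ((S.image fun c : ℝ => (c : ℂ)) : Set ℂ)) := fun a b => by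
    simp only [hM, inner_smul_right]
    exact hs.mul (differentiableOn_const _)
  have hr' : ∀ a b, ∀ c ∈ S, Tendsto (fun z : ℂ => (z - c) * ⟪v b, M z (v a)⟫_ℂ) (𝓝[≠] (c : ℂ)) (𝓝 ⟪v b, R c (v a)⟫_ℂ) := fun a b c hc => by
    simp only [hM, hR, inner_smul_right, ← mul_assoc]
    exact (hr c hc).mul_const _
  have hB' : ∀ a b, ∀ z : ℂ, 1 / 2 < z.re → z.re ≤ σ₀ → 1 ≤ |z.im| → ‖⟪v b, M z (v a)⟫_ℂ‖ ≤ B * ∑ a', ∑ b', ‖⟪v b', v a'⟫_ℂ‖ := fun a b z h1 h2 h3 => by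
    rw [hM, inner_smul_right, norm_mul]
    have hab : ‖⟪v b, v a⟫_ℂ‖ ≤ ∑ a', ∑ b', ‖⟪v b', v a'⟫_ℂ‖ :=
      (Finset.single_le_sum (f := fun b' => ‖⟪v b', v a⟫_ℂ‖) (fun _ _ => norm_nonneg _) (Finset.mem_univ b)).trans
        (Finset.single_le_sum (f := fun a' => ∑ b', ‖⟪v b', v a'⟫_ℂ‖) (fun _ _ => Finset.sum_nonneg fun _ _ => norm_nonneg _) (Finset.mem_univ a))
    exact mul_le_mul (hB z h1 h2 h3) hab (norm_nonneg _) hB0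
  have hRsymm : ∀ c ∈ S, ∀ u u' : V, ⟪u, R c u'⟫_ℂ = ⟪R c u, u'⟫_ℂ := fun c hc u u' => by
    rw [hR, hR, inner_smul_right, inner_smul_left, Complex.conj_eq_iff_im.2 (hρim c hc)]
  have hRpos : ∀ c ∈ S, ∀ u : V, 0 ≤ RCLike.re ⟪u, R c u⟫_ℂ := fun c hc u => by
    have h0 : 0 ≤ RCLike.re ⟪u, u⟫_ℂ := inner_self_nonneg
    rw [RCLike.re_to_complex] at h0
    rw [hR, inner_smul_right, RCLike.re_to_complex, Complex.mul_re, hρim c hc, zero_mul, sub_zero]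
    exact mul_nonneg (hρre c hc) h0
  have hFE' : ∀ z : ℂ, z ∉ P → 1 - z ∉ P → ∀ u : V, M (1 - z) (M z u) = u := fun z hz hz' u => by
    rw [hM, hM, smul_smul, mul_comm, hFE z hz hz', one_smul]
  have hadj' : ∀ z : ℂ, z ∉ P → conj z ∉ P → ∀ u u' : V, ⟪u, M z u'⟫_ℂ = ⟪M (conj z) u, u'⟫_ℂ := fun z hz hz' u u' => by
    rw [hM, hM, inner_smul_right, inner_smul_left, hconj z hz hz', Complex.conj_conj]
  have hcont' : ∀ u : V, Continuous fun t : ℝ => M ((((1 / 2 : ℝ)) : ℂ) + t * I) u := fun u => by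
    simp only [hM]
    exact hcont.smul continuous_const
  have hSD' : ∀ i j a b, ⟪y i b, y j a⟫_ℂ = (C : ℂ) * ((((2 * π)⁻¹ : ℝ) : ℂ) * ∫ t : ℝ, mellin (f j a) (-((σ₀ : ℂ) + t * I)) *
      (⟪v b, v a⟫_ℂ * conj (mellin (f i b) (-(1 - conj ((σ₀ : ℂ) + t * I)))) + ⟪v b, M ((σ₀ : ℂ) + t * I) (v a)⟫_ℂ * conj (mellin (f i b) (-conj ((σ₀ : ℂ) + t * I))))) := by
    intro i j a b
    simp only [hM, inner_smul_right]
    exact hSD i j a b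
  obtain ⟨r, w, Uiso, h1, h2, h3⟩ := exists_linearIsometry_selfDual_of_pureTensor_letters y hf hfs hf0 v M hσ₀ hUo hUs S hS hs' R hr' hB' hRsymm hRpos hPcd hFE' hadj' hcont' hC hSD'
  refine ⟨r, w, Uiso, fun i j => ?_, fun i => ?_, h3⟩
  · simpa only [hR] using h1 i j
  · simpa only [hM] using h2 i

end Generic

/-! ## §2 HEAD: the M1 print for `U(1,1)_{L∕L⁺}` — `hadj` and `hcont` discharged, the remaining bill visible -/

section CM

variable (L : Type) [Field L] [NumberField L] [IsCMField L]
variable [MeasurableSpace (quasiSplit (↥(maximalRealSubfield L)) L (IsCMField.complexConj L) 2).Adelic] [BorelSpace (quasiSplit (↥(maximalRealSubfield L)) L (IsCMField.complexConj L) 2).Adelic]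

/-- **HEAD — THE PLANCHEREL ISOMETRY OF A SELF-DUAL `χ`-BLOCK OF `U(1,1)_{L∕L⁺}` AT THE MAXIMAL LEVEL (`K′ = K_max`, `ω = 1`), ON THE REMAINING SCALAR LETTERS.**  Data: `L²(X, μ)`;
a measure `μ_K` on `K_max`; the `L²(K_max)`-model `W := span {v_a} ≤ L²(K_max, μ_K)` (★ part 5 §3: `v_a =ᵐ φ_a|_{K_max}`, `φ_a ∈ V(χ, K_max, 1)`); test functions `f_{i,a} ∈ C²_c((0,∞))` and
classes `y_{i,a} ∈ L²(X, μ)` (E1: `=ᵐ θ_{f_{i,a},φ_a}`, ★ part 5 §4 `exists_classRep_cm_two`); THE M1 DATUM: a self-dual (`χʷ = χ`) unitary Hecke character `χ` of `L`, a normalised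
section `φ₀ ∈ V(χ, K_max, 1)` (`φ₀(1) ∈ ℝ`), an inversion-invariant measure `ν` on `N(𝔸)` and a real constant `r`; its SCATTERING SCALAR PACKAGE `(s, P)` — `s` meromorphic in normal form
on `ℂ`, analytic off a closed co-discrete `P ⊆ {Re ≤ 1}`, Godement-range formula `s(z) = r·φ₀(1)⁻¹·∫_{N(𝔸)} f_z^{φ₀}(w₀ v) dν` on `{1 < Re z}` (★ M1 PRINT (E1)–(E3)).  DISCHARGED INSIDE:
`hadj` (= conj-symmetry of `s`, ★ `chi_scattering_conj_symm_m1_cm_two` over the Galois twist ★ `exists_galTwist_cm`, right-`K_max`-invariance ★ `apply_mul_of_mem`) and `hcont` (no pole on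
the unitary axis, ★ `continuous_axis_of_fe_of_conj`).  VISIBLE BILL: `hs` (holomorphy of `s` on an open `U ⊇ {½ ≤ Re ≤ σ₀}` off the finset `S ⊂ (½, σ₀)` of real poles), `hr∕hρim∕hρre`
(simple poles at `S` with real residues `ρ_c ≥ 0`), `hB` (strip bound at `|Im| ≥ 1`), `hFE` (`s(z)s(1−z) = 1` off `P ∪ (1 − P)`), `hSD` (the pure-tensor two-term Gram letter on
`Re z = σ₀` with coefficients `⟪ṽ_b, ṽ_a⟫_W` and `s(z)·⟪ṽ_b, ṽ_a⟫_W`).  CONCLUSION: `∃ r w U`, `⟪r_i, r_j⟫ = C·Σ_{c∈S} ⟪Ψ̂_i(−c), ρ_c•Ψ̂_j(−c)⟫_W`,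
`w_i =ᵐ Ψ̂_i(−(½+it)) + s(½−it)•Ψ̂_i(−(½−it))`, **`U (Σ_a y_{i,a}) = (r_i, √(C∕2π)•w_i)`**, `U : closure span {Σ_a y_{i,a}} →ₗᵢ[ℂ] (⊕_{c∈S} W) ⊕₂ L²((0,∞); W)` — ROADCARD §3′
D4′c (SD) at M1. [cite: MoeglinWaldspurger1995, II.2.4, IV.1.10 and IV.3.12] [cite: Langlands1976, §7] [cite: Iwaniec2002, §7.3] -/
theorem exists_linearIsometry_chiSection_selfDual_m1_cm_two
    (μ : Measure (quasiSplit (↥(maximalRealSubfield L)) L (IsCMField.complexConj L) 2).automorphicQuotient)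
    (μK : Measure ((standardMaximalCompactGL 2 L).comap (adelicVal (↥(maximalRealSubfield L)) L (IsCMField.complexConj L) 2 ((StdForm.antidiagonal 2).over L)) : Subgroup (quasiSplit (↥(maximalRealSubfield L)) L (IsCMField.complexConj L) 2).Adelic))
    {ι α : Type*} [Fintype α]
    (v : α → Lp ℂ 2 μK) (y : ι → α → Lp ℂ 2 μ) {f : ι → α → ℝ → ℂ}
    (hf : ∀ i a, ContDiff ℝ 2 (f i a)) (hfs : ∀ i a, HasCompactSupport (f i a)) (hf0 : ∀ i a, tsupport (f i a) ⊆ Ioi 0)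
    -- the M1 datum: a self-dual unitary `χ`, a normalised section `φ₀ ∈ V(χ, K_max, 1)` (`φ₀(1) ∈ ℝ`), `ν` on `N(𝔸)` and the real constant `r`
    {χ : HeckeCharacter L} (hsd : reflectChar (IsCMField.complexConj L) χ = χ) (hχ : χ.IsUnitary)
    {φ₀ : (quasiSplit (↥(maximalRealSubfield L)) L (IsCMField.complexConj L) 2).Adelic → ℂ}
    (hφ₀V : φ₀ ∈ chiSectionSpace χ ((standardMaximalCompactGL 2 L).comap (adelicVal (↥(maximalRealSubfield L)) L (IsCMField.complexConj L) 2 ((StdForm.antidiagonal 2).over L)) : Subgroup (quasiSplit (↥(maximalRealSubfield L)) L (IsCMField.complexConj L) 2).Adelic) (fun _ => 1))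
    (hφ₀1 : conj (φ₀ 1) = φ₀ 1)
    (ν : Measure ↥(adelicUnipotent (↥(maximalRealSubfield L)) L (IsCMField.complexConj L) 2)) [ν.IsInvInvariant] (r : ℝ)
    -- the scattering scalar package `(s, P)` of `(χ, φ₀)` (★ M1 PRINT (E1)–(E3) in the basis `{φ₀}`, read at `g = 1`)
    {s : ℂ → ℂ} {P : Set ℂ} (hsNF : MeromorphicNFOn s univ) (hPc : IsClosed P) (hPcd : ∀ z₀ : ℂ, ∀ᶠ w in 𝓝[≠] z₀, w ∉ P) (hPre : ∀ z ∈ P, z.re ≤ 1)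
    (hsan : ∀ z : ℂ, z ∉ P → AnalyticAt ℂ s z)
    (hs_tube : ∀ z : ℂ, 1 < z.re → s z = ((r : ℝ) : ℂ) * ((φ₀ 1)⁻¹ * ∫ u : ↥(adelicUnipotent (↥(maximalRealSubfield L)) L (IsCMField.complexConj L) 2), flatSectionU φ₀ z
        ((quasiSplit (↥(maximalRealSubfield L)) L (IsCMField.complexConj L) 2).toAdelic (weylLongU (IsCMField.complexConj L : L →+* L)
          (rfl : (StdForm.antidiagonal 2).over L = (StdForm.antidiagonal 2).over L)) * ((u : (quasiSplit (↥(maximalRealSubfield L)) L (IsCMField.complexConj L) 2).Adelic) * 1)) ∂ν))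
    -- THE REMAINING (SD)-AT-M1 BILL — visible letters, scalar currency
    {σ₀ : ℝ} (hσ₀ : 1 / 2 < σ₀)
    {U : Set ℂ} (hUo : IsOpen U) (hUs : {z : ℂ | 1 / 2 ≤ z.re ∧ z.re ≤ σ₀} ⊆ U) (S : Finset ℝ) (hS : ∀ c ∈ S, 1 / 2 < c ∧ c < σ₀)
    (hs : DifferentiableOn ℂ s (U \ ((S.image fun c : ℝ => (c : ℂ)) : Set ℂ)))
    (ρ : ℝ → ℂ) (hr : ∀ c ∈ S, Tendsto (fun z : ℂ => (z - c) * s z) (𝓝[≠] (c : ℂ)) (𝓝 (ρ c)))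
    (hρim : ∀ c ∈ S, (ρ c).im = 0) (hρre : ∀ c ∈ S, 0 ≤ (ρ c).re)
    {B : ℝ} (hB : ∀ z : ℂ, 1 / 2 < z.re → z.re ≤ σ₀ → 1 ≤ |z.im| → ‖s z‖ ≤ B)
    (hFE : ∀ z : ℂ, z ∉ P → 1 - z ∉ P → s z * s (1 - z) = 1)
    {C : ℝ} (hC : 0 ≤ C)
    (hSD : ∀ i j a b, ⟪y i b, y j a⟫_ℂ = (C : ℂ) * ((((2 * π)⁻¹ : ℝ) : ℂ) * ∫ t : ℝ, mellin (f j a) (-((σ₀ : ℂ) + t * I)) *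
      (⟪(⟨v b, Submodule.subset_span ⟨b, rfl⟩⟩ : ↥(Submodule.span ℂ (Set.range v))), ⟨v a, Submodule.subset_span ⟨a, rfl⟩⟩⟫_ℂ * conj (mellin (f i b) (-(1 - conj ((σ₀ : ℂ) + t * I)))) +
        s ((σ₀ : ℂ) + t * I) * ⟪(⟨v b, Submodule.subset_span ⟨b, rfl⟩⟩ : ↥(Submodule.span ℂ (Set.range v))), ⟨v a, Submodule.subset_span ⟨a, rfl⟩⟩⟫_ℂ *
          conj (mellin (f i b) (-conj ((σ₀ : ℂ) + t * I)))))) :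
    ∃ (r' : ι → PiLp 2 (fun _ : ↥S => ↥(Submodule.span ℂ (Set.range v)))) (w : ι → Lp ↥(Submodule.span ℂ (Set.range v)) 2 ((volume : Measure ℝ).restrict (Ioi 0)))
      (Uiso : (Submodule.span ℂ (Set.range fun i => ∑ a, y i a)).topologicalClosure →ₗᵢ[ℂ]
        WithLp 2 (PiLp 2 (fun _ : ↥S => ↥(Submodule.span ℂ (Set.range v))) × Lp ↥(Submodule.span ℂ (Set.range v)) 2 ((volume : Measure ℝ).restrict (Ioi 0)))),
      (∀ i j, ⟪r' i, r' j⟫_ℂ = (C : ℂ) * ∑ c ∈ S, ⟪∑ b, mellin (f i b) (-(c : ℂ)) • (⟨v b, Submodule.subset_span ⟨b, rfl⟩⟩ : ↥(Submodule.span ℂ (Set.range v))),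
        ρ c • ∑ a, mellin (f j a) (-(c : ℂ)) • (⟨v a, Submodule.subset_span ⟨a, rfl⟩⟩ : ↥(Submodule.span ℂ (Set.range v)))⟫_ℂ) ∧
      (∀ i, (w i : ℝ → ↥(Submodule.span ℂ (Set.range v))) =ᵐ[(volume : Measure ℝ).restrict (Ioi 0)] fun t =>
        (∑ a, mellin (f i a) (-((((1 / 2 : ℝ)) : ℂ) + t * I)) • (⟨v a, Submodule.subset_span ⟨a, rfl⟩⟩ : ↥(Submodule.span ℂ (Set.range v)))) +
          s ((((1 / 2 : ℝ)) : ℂ) + ((-t : ℝ) : ℂ) * I) •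
            ∑ a, mellin (f i a) (-((((1 / 2 : ℝ)) : ℂ) + ((-t : ℝ) : ℂ) * I)) • (⟨v a, Submodule.subset_span ⟨a, rfl⟩⟩ : ↥(Submodule.span ℂ (Set.range v)))) ∧
      (∀ i, Uiso ⟨∑ a, y i a, mem_topologicalClosure_span (fun i => ∑ a, y i a) i⟩ = WithLp.toLp 2 (r' i, ((Real.sqrt (C * (2 * π)⁻¹) : ℝ) : ℂ) • w i)) := by
  haveI : FiniteDimensional ℂ ↥(Submodule.span ℂ (Set.range v)) := finiteDimensional_span_range v
  -- (hadj) at M1 = the conj-symmetry of the rank-one scattering scalar (★ p860445), over the Galois twist of `U(1,1)(𝔸_{L⁺})`; right-`K_max`-invariance of `φ₀` from `ω = 1`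
  have hφ₀K : ∀ k : (quasiSplit (↥(maximalRealSubfield L)) L (IsCMField.complexConj L) 2).Adelic,
      adelicVal (↥(maximalRealSubfield L)) L (IsCMField.complexConj L) 2 ((StdForm.antidiagonal 2).over L) k ∈ standardMaximalCompactGL 2 L → ∀ g, φ₀ (g * k) = φ₀ g :=
    fun k hk g => by simpa only [one_mul] using apply_mul_of_mem hφ₀V g ⟨k, hk⟩
  have hconj : ∀ z : ℂ, z ∉ P → conj z ∉ P → s (conj z) = conj (s z) := by
    obtain ⟨cG, hcG⟩ := exists_galTwist_cm L
    exact chi_scattering_conj_symm_m1_cm_two L hcG ν r hsd hχ (isChiSection_of_mem hφ₀V) hφ₀K hφ₀1 hφ₀1 hPc hPcd hPre hsan hs_tube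
  -- (hcont) at M1 = no pole on the unitary axis (★ p860080)
  have hcont : Continuous fun t : ℝ => s ((((1 / 2 : ℝ)) : ℂ) + t * I) := continuous_axis_of_fe_of_conj hsNF hPcd hFE hconj
  exact exists_linearIsometry_selfDual_of_scalar_letters y hf hfs hf0 (fun a => (⟨v a, Submodule.subset_span ⟨a, rfl⟩⟩ : ↥(Submodule.span ℂ (Set.range v)))) s hσ₀ hUo hUs S hS
    hs ρ hr hρim hρre hB hPcd hFE hconj hcont hC hSD

end CM

end Summit.HodgeConjecture.HodgeConjecture.Cruxes.H413.K2E1ChiSectionPlancherelSelfDualM1CMTwo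

end
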